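import Summits.CriticalPhenomena.CardyFormulaZ2.Theorems.CardyBoundaryCoulombGasHalfPlaneMarkDensityLawNoFreeConstant

/-!
# Proportionality line, step P3: self-duality on the diagonal forces `m ≡ 1`
(crux `HalfPlaneMarkDensityLaw`, line `Sketch`)

If the wired three-mark kernel tends along a strictly increasing `θ` to `m(σ)·F(x/(x+σ))` for all
`σ, x > 0`, then on the diagonal `x = σ` the duality–reflection law
(`SelfDual.selfDual_diagonal`: `P_n(σ,σ) → 1/2`) and `F(1/2) = 1/2`
(`NoFreeConstant.cardyFunction_one_half`) give `m(σ)·(1/2) = 1/2`, i.e. `m(σ) = 1`.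
-/

noncomputable section

namespace Summit.CriticalPhenomena.CardyFormulaZ2.Cruxes.HalfPlaneMarkDensityLaw.SketchLine

open Literature.Probability.Percolation Literature.Probability.LatticeModels
open Literature.Probability.RandomPlanarGeometry (crossRatio)
open MeasureTheory Filter Set
open scoped Topology
open Summit.CriticalPhenomena.CardyFormulaZ2.Theorems.HalfPlaneMarkDensityLaw.Negative

namespace Proportional

/-- **P3: the duality–reflection law on the diagonal forces `m ≡ 1`.**  If along a strictly
increasing `θ` the wired kernel `P_{θ n}(σ, x)` tends to `m(σ)·F(x/(x+σ))` for all `σ, x > 0`, then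
`m(σ) = 1` for every `σ > 0`: at `x = σ` the limit is `m(σ)·F(1/2) = m(σ)/2`, while self-duality
gives `P_{θ n}(σ,σ) → 1/2` along the subsequence; uniqueness of limits concludes. [folklore] -/
theorem stub_prop_selfDual :
    ∀ {θ : ℕ → ℕ}, StrictMono θ → ∀ (mfun : ℝ → ℝ),
      (∀ σ x : ℝ, 0 < σ → 0 < x →
        Tendsto (fun n ↦ μ.real (openCrossing halfPlane {v : Site 2 | v 1 = 0 ∧ v 0 ≤ -⌊σ * (θ n : ℕ)⌋}
          {v : Site 2 | v 1 = 0 ∧ 1 ≤ v 0 ∧ v 0 ≤ ⌊x * (θ n : ℕ)⌋})) atTop (𝓝 (mfun σ * Literature.Probability.RandomPlanarGeometry.cardyFunction (x / (x + σ))))) →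
      ∀ σ : ℝ, 0 < σ → mfun σ = 1 := by
  intro θ hθ mfun hlim σ hσ
  -- the hypothesis on the diagonal `x = σ`: the limit is `m(σ)·F(σ/(σ+σ)) = m(σ)·F(1/2) = m(σ)/2`
  have hw := hlim σ σ hσ hσ
  have hhalf : σ / (σ + σ) = 1 / 2 := by
    rw [← two_mul, mul_comm, div_mul_eq_div_div, div_self hσ.ne']
  rw [hhalf, NoFreeConstant.cardyFunction_one_half] at hw
  -- self-duality on the diagonal, along the subsequence `θ`
  have hsd := (SelfDual.selfDual_diagonal hσ).comp hθ.tendsto_atTop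
  -- uniqueness of limits: `1/2 = m(σ)·(1/2)`
  have h := tendsto_nhds_unique hsd hw
  linarith

end Proportional

end Summit.CriticalPhenomena.CardyFormulaZ2.Cruxes.HalfPlaneMarkDensityLaw.SketchLine
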